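import Literature.Geometry.Lorentzian.Stationary
import Literature.Geometry.Lorentzian.OpensCausality
import Literature.Geometry.Lorentzian.CausalityPushUp
import Literature.Geometry.Lorentzian.Isometry
import Literature.Geometry.Lorentzian.BackgroundChartCalculus
import HarnessLib

/-!
# Route PhotonSphereChannels · crux `ChannelsResolveTameDevelopmentsR` (K2R-T2, stmt-FinalStateConjecture-17430) ·
# line `tame-lasalle-dock` · stub D `stub_dockReadyHull`: causality of an OPEN SUB-SPACETIME

Stub D asks, for every silent hull element `(𝓢, E, p)`, for a globally hyperbolic REPRESENTATIVE `(𝓢', E')` with an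
injective local isometry `j : 𝓢' → 𝓢` preserving future-directedness and `j '' E'.doc = E.doc`. The intended witness is
an open sub-spacetime `U ⊇ E.doc ∪ range E.far` of `𝓢` (`Spacetime.restrict`), `j = Subtype.val`. This file supplies
the closable, purely causal pieces of that construction: §1 the inclusion of a connected open sub-spacetime is an
injective local isometry whose differential (`= id`, `mfderiv_subtypeVal`) preserves future-directedness; §2 future
timelike curves of `𝓢` with values in `U` are future timelike curves of `𝓢|_U` (parameter clamped outside a
neighbourhood of `[a, b]`), so `I^±_U ⊆ I^±`; §3 timelike curves from `M_ext` to `I⁻(M_ext)` (or its closure) and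
from `I⁺(M_ext)` to `M_ext` run inside `⟨⟨M_ext⟩⟩` (transitivity of `≪`, openness of `I⁺`); §4 for
`M_ext ∪ ⟨⟨M_ext⟩⟩ ⊆ U` the d.o.c. AND the future event horizon of `M_ext` computed in `𝓢|_U` are the preimages of
those of `𝓢` (`docOfEnd_restrict_eq_preimage`, registered sub-goal; `futureEventHorizonOfEnd_restrict_eq_preimage`),
the black-hole region only grows and is nonempty as soon as `U` contains one horizon point. No route item is restated.

References: O'Neill 1983, Ch. 1 pp. 3–7, Ch. 3 pp. 57, 90–91, Ch. 5 p. 145, Ch. 14 pp. 402–403 [ONeill1983];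
Wald 1984, §12.1 [Wald1984]; Chruściel–Costa 2008, §2.2 [ChruscielCosta2008]; Sbierski 2016, §3.1 [Sbierski2016AHP].
-/

noncomputable section

set_option linter.dupNamespace false

open Set Filter Function TopologicalSpace Manifold Bundle
open scoped Topology Manifold ContDiff

namespace Summit.FinalStateConjecture.FinalStateConjecture.Theorems.TameLaSalle

open Literature.Geometry.Lorentzian

variable (𝓢 : Spacetime.{0} 4) (U : Opens 𝓢.carrier) (hU : IsConnected (U : Set 𝓢.carrier))

/-! ### §1 The inclusion of an open sub-spacetime -/

/-- **The inclusion of a connected open sub-spacetime is a local isometry**: `Subtype.val : U → 𝓢` is a `C^∞`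
local diffeomorphism (`isLocalDiffeomorph_subtypeVal`) and `ι^* g = g|_U` because `dι = id`
(`mfderiv_subtypeVal`). O'Neill 1983, Ch. 3, p. 57 and pp. 90–91. [cite: ONeill1983, Ch. 3, pp. 90–91] -/
theorem isLocalIsometry_subtypeVal_restrict :
    PseudoRiemannianMetric.IsLocalIsometry
      (𝓢.restrict PseudoRiemannianMetric.contMDiff_restrict_holds 𝓢.timeOrientation.contMDiff_restrict_holds
        U hU).metric.toPseudoRiemannianMetric 𝓢.metric.toPseudoRiemannianMetric
      (Subtype.val : U → 𝓢.carrier) := by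
  refine ⟨isLocalDiffeomorph_subtypeVal (I := 𝓡 4) U, fun y ↦ ?_⟩
  ext v w
  change 𝓢.metric.val y.1 (mfderiv (𝓡 4) (𝓡 4) (Subtype.val : U → 𝓢.carrier) y v)
    (mfderiv (𝓡 4) (𝓡 4) (Subtype.val : U → 𝓢.carrier) y w) = 𝓢.metric.val y.1 v w
  rw [mfderiv_subtypeVal]
  rfl

/-- The inclusion of an open sub-spacetime is injective. [folklore] -/
theorem injective_subtypeVal_restrict : Function.Injective (Subtype.val :
    (𝓢.restrict PseudoRiemannianMetric.contMDiff_restrict_holds 𝓢.timeOrientation.contMDiff_restrict_holds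
      U hU).carrier → 𝓢.carrier) := Subtype.val_injective

/-- **Future-directedness in the sub-spacetime is future-directedness in `𝓢`** (`T_y U = T_y 𝓢`, same metric
and same orienting vector at the point). O'Neill 1983, Ch. 5, p. 145 and Ch. 1, p. 7. [cite: ONeill1983, Ch. 5, p. 145] -/
theorem isFutureDirected_restrict_iff
    (y : (𝓢.restrict PseudoRiemannianMetric.contMDiff_restrict_holds 𝓢.timeOrientation.contMDiff_restrict_holds
      U hU).carrier) (v : TangentSpace (𝓡 4) y) :
    (𝓢.restrict PseudoRiemannianMetric.contMDiff_restrict_holds 𝓢.timeOrientation.contMDiff_restrict_holds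
        U hU).timeOrientation.IsFutureDirected v ↔
      𝓢.timeOrientation.IsFutureDirected (x := y.1) v :=
  Iff.rfl

/-- **The differential of the inclusion preserves future-directedness** (`dι = id`): the orientation clause
of the representative in stub D for the sub-spacetime witness. O'Neill 1983, Ch. 5, p. 145. [cite: ONeill1983, Ch. 5, p. 145] -/
theorem isFutureDirected_mfderiv_subtypeVal_restrict
    (y : (𝓢.restrict PseudoRiemannianMetric.contMDiff_restrict_holds 𝓢.timeOrientation.contMDiff_restrict_holds
      U hU).carrier) (v : TangentSpace (𝓡 4) y)
    (hv : (𝓢.restrict PseudoRiemannianMetric.contMDiff_restrict_holds 𝓢.timeOrientation.contMDiff_restrict_holds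
      U hU).timeOrientation.IsFutureDirected v) :
    𝓢.timeOrientation.IsFutureDirected (mfderiv (𝓡 4) (𝓡 4) (Subtype.val : U → 𝓢.carrier) y v) := by
  rw [mfderiv_subtypeVal]
  exact hv

/-! ### §2 Timelike curves with values in `U` are timelike curves of `𝓢|_U` -/

variable {𝓢 U}

/-- **A future timelike curve of `𝓢` on `[a, b]` with values in the open set `U` is a future timelike curve of
the sub-spacetime `𝓢|_U` on `[a, b]`** (after clamping the parameter to a neighbourhood of `[a, b]` on which the
curve stays in `U`, which exists by continuity at the endpoints; the clamped curve has the same germ at every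
`t ∈ [a, b]`, `LorentzianMetric.timelike_of_eventuallyEq`, and timelike curves of `𝓢|_U` are those of `𝓢` lying
in `U`, `LorentzianMetric.isFutureTimelikeCurveOn_restrict_iff`). Sbierski 2016, §3.1. [cite: Sbierski2016AHP, §3.1] -/
theorem exists_curve_codRestrict_restrict {γ : ℝ → 𝓢.carrier} {a b : ℝ} (hab : a ≤ b)
    (hγ : 𝓢.metric.IsFutureTimelikeCurveOn 𝓢.timeOrientation γ (Icc a b))
    (hmem : ∀ t ∈ Icc a b, γ t ∈ U) :
    ∃ γ' : ℝ → U, (∀ t ∈ Icc a b, (γ' t : 𝓢.carrier) = γ t) ∧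
      (𝓢.restrict PseudoRiemannianMetric.contMDiff_restrict_holds 𝓢.timeOrientation.contMDiff_restrict_holds
        U hU).metric.IsFutureTimelikeCurveOn
        (𝓢.restrict PseudoRiemannianMetric.contMDiff_restrict_holds 𝓢.timeOrientation.contMDiff_restrict_holds
          U hU).timeOrientation γ' (Icc a b) := by
  have ha : a ∈ Icc a b := ⟨le_rfl, hab⟩
  have hb : b ∈ Icc a b := ⟨hab, le_rfl⟩
  -- the curve stays in `U` slightly beyond the endpoints
  obtain ⟨ε₁, hε₁, h₁⟩ := Metric.mem_nhds_iff.1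
    ((hγ a ha).1.continuousAt.preimage_mem_nhds (U.isOpen.mem_nhds (hmem a ha)))
  obtain ⟨ε₂, hε₂, h₂⟩ := Metric.mem_nhds_iff.1
    ((hγ b hb).1.continuousAt.preimage_mem_nhds (U.isOpen.mem_nhds (hmem b hb)))
  set ε : ℝ := min ε₁ ε₂ with hε_def
  have hε : 0 < ε := lt_min hε₁ hε₂
  have hεle₁ : ε ≤ ε₁ := min_le_left _ _
  have hεle₂ : ε ≤ ε₂ := min_le_right _ _
  -- the clamp of the parameter
  set c : ℝ → ℝ := fun t ↦ max (a - ε / 2) (min t (b + ε / 2)) with hc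
  have hcU : ∀ t, γ (c t) ∈ U := by
    intro t
    have hlow : a - ε / 2 ≤ c t := le_max_left _ _
    have hup : c t ≤ b + ε / 2 := max_le (by linarith) (min_le_right _ _)
    by_cases hlt : c t < a
    · exact h₁ (Metric.mem_ball.2 (by rw [Real.dist_eq, abs_lt]; constructor <;> linarith))
    by_cases hgt : b < c t
    · exact h₂ (Metric.mem_ball.2 (by rw [Real.dist_eq, abs_lt]; constructor <;> linarith))
    · push Not at hlt hgt
      exact hmem _ ⟨hlt, hgt⟩
  have hcid : ∀ s ∈ Ioo (a - ε / 2) (b + ε / 2), c s = s := fun s hs ↦ by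
    simp only [hc]
    rw [min_eq_left hs.2.le, max_eq_right hs.1.le]
  refine ⟨fun t ↦ ⟨γ (c t), hcU t⟩, fun t ht ↦ congrArg γ (hcid t ⟨by linarith [ht.1], by linarith [ht.2]⟩), ?_⟩
  refine (LorentzianMetric.isFutureTimelikeCurveOn_restrict_iff 𝓢.metric 𝓢.timeOrientation
    PseudoRiemannianMetric.contMDiff_restrict_holds 𝓢.timeOrientation.contMDiff_restrict_holds U).2 ?_
  intro t ht
  have hev : (Subtype.val ∘ fun t ↦ (⟨γ (c t), hcU t⟩ : U)) =ᶠ[𝓝 t] γ := by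
    filter_upwards [Ioo_mem_nhds (show a - ε / 2 < t by linarith [ht.1]) (show t < b + ε / 2 by linarith [ht.2])]
      with s hs
    exact congrArg γ (hcid s hs)
  exact LorentzianMetric.timelike_of_eventuallyEq hev (hγ t ht).1 (hγ t ht).2.1 (hγ t ht).2.2

/-- **`I⁺` of the sub-spacetime lies in `I⁺` of `𝓢`**: a timelike curve of `𝓢|_U` is a timelike curve of `𝓢`.
O'Neill 1983, Ch. 14, p. 402; Sbierski 2016, §3.1. [cite: ONeill1983, Ch. 14, p. 402] -/
theorem chronologicalFuture_restrict_subset_preimage (S : Set U) :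
    (𝓢.restrict PseudoRiemannianMetric.contMDiff_restrict_holds 𝓢.timeOrientation.contMDiff_restrict_holds
        U hU).metric.chronologicalFuture
        (𝓢.restrict PseudoRiemannianMetric.contMDiff_restrict_holds 𝓢.timeOrientation.contMDiff_restrict_holds
          U hU).timeOrientation S ⊆
      Subtype.val ⁻¹' 𝓢.metric.chronologicalFuture 𝓢.timeOrientation (Subtype.val '' S) := by
  rintro q ⟨p, hp, γ, a, b, hab, hγ, hpa, hqb⟩
  refine ⟨p.1, ⟨p, hp, rfl⟩, Subtype.val ∘ γ, a, b, hab,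
    (LorentzianMetric.isFutureTimelikeCurveOn_restrict_iff 𝓢.metric 𝓢.timeOrientation
      PseudoRiemannianMetric.contMDiff_restrict_holds 𝓢.timeOrientation.contMDiff_restrict_holds U).1 hγ,
    ?_, ?_⟩
  · simp [hpa]
  · simp [hqb]

/-- **`I⁻` of the sub-spacetime lies in `I⁻` of `𝓢`** (time dual: the reversed restricted orientation is the
restricted reversed orientation, definitionally). O'Neill 1983, Ch. 14, p. 403. [cite: ONeill1983, Ch. 14, p. 403] -/
theorem chronologicalPast_restrict_subset_preimage (S : Set U) :
    (𝓢.restrict PseudoRiemannianMetric.contMDiff_restrict_holds 𝓢.timeOrientation.contMDiff_restrict_holds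
        U hU).metric.chronologicalPast
        (𝓢.restrict PseudoRiemannianMetric.contMDiff_restrict_holds 𝓢.timeOrientation.contMDiff_restrict_holds
          U hU).timeOrientation S ⊆
      Subtype.val ⁻¹' 𝓢.metric.chronologicalPast 𝓢.timeOrientation (Subtype.val '' S) := by
  rintro q ⟨p, hp, γ, a, b, hab, hγ, hpa, hqb⟩
  refine ⟨p.1, ⟨p, hp, rfl⟩, Subtype.val ∘ γ, a, b, hab,
    (LorentzianMetric.isFutureTimelikeCurveOn_restrict_iff 𝓢.metric 𝓢.timeOrientation.reverse
      PseudoRiemannianMetric.contMDiff_restrict_holds 𝓢.timeOrientation.reverse.contMDiff_restrict_holds U).1 hγ,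
    ?_, ?_⟩
  · simp [hpa]
  · simp [hqb]

/-! ### §3 Timelike curves between `M_ext` and its domain of outer communications stay in it -/

section Ambient

variable {E' : Type*} [NormedAddCommGroup E'] [NormedSpace ℝ E'] {H' : Type*} [TopologicalSpace H']
  {I' : ModelWithCorners ℝ E' H'} {n : ℕ∞ω} {M : Type*} [TopologicalSpace M] [ChartedSpace H' M]
  [IsManifold I' ∞ M] {g : LorentzianMetric I' n M} {τ : TimeOrientation g}

/-- `x ∈ I⁻(S)` iff some point of `S` lies in `I⁺(x)` (time duality, pointwise). O'Neill 1983, Ch. 14,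
pp. 402–403. [cite: ONeill1983, Ch. 14, pp. 402–403] -/
theorem mem_chronologicalPast_iff_exists_mem_chronologicalFuture {S : Set M} {x : M} :
    x ∈ g.chronologicalPast τ S ↔ ∃ s ∈ S, s ∈ g.chronologicalFuture τ {x} := by
  -- adapted from `LorentzianMetric.mem_chronologicalPast_iff_exists` (NoncompactCauchyFutureSet.lean)
  constructor
  · intro h
    rw [LorentzianMetric.chronologicalPast, LorentzianMetric.chronologicalFuture_eq_biUnion] at h
    simp only [mem_iUnion, exists_prop] at h
    obtain ⟨s, hs, hxs⟩ := h
    exact ⟨s, hs, LorentzianMetric.mem_chronologicalFuture_of_mem_chronologicalPast hxs⟩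
  · rintro ⟨s, hs, hsx⟩
    rw [LorentzianMetric.chronologicalPast, LorentzianMetric.chronologicalFuture_eq_biUnion]
    simp only [mem_iUnion, exists_prop]
    exact ⟨s, hs, LorentzianMetric.mem_chronologicalPast_of_mem_chronologicalFuture hsx⟩

/-- **A future timelike curve from `M_ext` to a point of `I⁻(M_ext)` runs inside `⟨⟨M_ext⟩⟩ = I⁺(M_ext) ∩ I⁻(M_ext)`**
(except possibly at its initial point): `γ t ∈ I⁺(γ a) ⊆ I⁺(M_ext)` along `γ|[a, t]`, and
`γ t ≪ γ b ≪ m ∈ M_ext` by `γ|[t, b]` and transitivity of `≪` (`mem_chronologicalFuture_trans`). Wald 1984,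
§12.1; O'Neill 1983, Ch. 14, p. 402. [cite: Wald1984, §12.1] -/
theorem mem_docOfEnd_of_curve_from {Mext : Set M} {γ : ℝ → M} {a b : ℝ}
    (hγ : g.IsFutureTimelikeCurveOn τ γ (Icc a b)) (hγa : γ a ∈ Mext)
    (hγb : γ b ∈ g.chronologicalPast τ Mext) {t : ℝ} (ht : t ∈ Ioc a b) :
    γ t ∈ g.docOfEnd τ Mext := by
  refine ⟨⟨γ a, hγa, γ, a, t, ht.1, hγ.mono (Icc_subset_Icc_right ht.2), rfl, rfl⟩, ?_⟩
  rcases ht.2.eq_or_lt with rfl | htb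
  · exact hγb
  · obtain ⟨m, hm, hmb⟩ := mem_chronologicalPast_iff_exists_mem_chronologicalFuture.1 hγb
    have hbt : γ b ∈ g.chronologicalFuture τ {γ t} :=
      ⟨γ t, rfl, γ, t, b, htb, hγ.mono (Icc_subset_Icc_left ht.1.le), rfl, rfl⟩
    exact mem_chronologicalPast_iff_exists_mem_chronologicalFuture.2
      ⟨m, hm, LorentzianMetric.mem_chronologicalFuture_trans hbt hmb⟩

/-- **A future timelike curve from a point of `I⁺(M_ext)` to `M_ext` runs inside `⟨⟨M_ext⟩⟩`** (except possibly at
its final point): time dual of `mem_docOfEnd_of_curve_from`. Wald 1984, §12.1. [cite: Wald1984, §12.1] -/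
theorem mem_docOfEnd_of_curve_to {Mext : Set M} {γ : ℝ → M} {a b : ℝ}
    (hγ : g.IsFutureTimelikeCurveOn τ γ (Icc a b)) (hγa : γ a ∈ g.chronologicalFuture τ Mext)
    (hγb : γ b ∈ Mext) {t : ℝ} (ht : t ∈ Ico a b) :
    γ t ∈ g.docOfEnd τ Mext := by
  refine ⟨?_, mem_chronologicalPast_iff_exists_mem_chronologicalFuture.2
    ⟨γ b, hγb, γ t, rfl, γ, t, b, ht.2, hγ.mono (Icc_subset_Icc_left ht.1), rfl, rfl⟩⟩
  rcases ht.1.eq_or_lt with rfl | hat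
  · exact hγa
  · exact LorentzianMetric.mem_chronologicalFuture_trans hγa
      ⟨γ a, rfl, γ, a, t, hat, hγ.mono (Icc_subset_Icc_right ht.2.le), rfl, rfl⟩

/-- **A future timelike curve from `M_ext` to a point of the closure of `I⁻(M_ext)` runs inside `⟨⟨M_ext⟩⟩`**
(interior parameters): `γ b ∈ I⁺(γ t)`, which is open (`isOpen_chronologicalFuture_of_boundaryless`) and hence
meets `I⁻(M_ext)`; transitivity. Used at horizon points `γ b ∈ ∂I⁻(M_ext)`. O'Neill 1983, Ch. 14, Lemma 14.3
and p. 402. [cite: ONeill1983, Ch. 14, Lemma 14.3 (p. 403)] -/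
theorem mem_docOfEnd_of_curve_from_of_mem_closure [BoundarylessManifold I' M] {Mext : Set M} {γ : ℝ → M}
    {a b : ℝ} (hγ : g.IsFutureTimelikeCurveOn τ γ (Icc a b)) (hγa : γ a ∈ Mext)
    (hγb : γ b ∈ closure (g.chronologicalPast τ Mext)) {t : ℝ} (ht : t ∈ Ioo a b) :
    γ t ∈ g.docOfEnd τ Mext := by
  refine ⟨⟨γ a, hγa, γ, a, t, ht.1, hγ.mono (Icc_subset_Icc_right ht.2.le), rfl, rfl⟩, ?_⟩
  have hbt : γ b ∈ g.chronologicalFuture τ {γ t} :=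
    ⟨γ t, rfl, γ, t, b, ht.2, hγ.mono (Icc_subset_Icc_left ht.1.le), rfl, rfl⟩
  obtain ⟨y, hyF, hyP⟩ := mem_closure_iff.1 hγb _
    (LorentzianMetric.isOpen_chronologicalFuture_of_boundaryless g τ {γ t}) hbt
  obtain ⟨m, hm, hmy⟩ := mem_chronologicalPast_iff_exists_mem_chronologicalFuture.1 hyP
  exact mem_chronologicalPast_iff_exists_mem_chronologicalFuture.2
    ⟨m, hm, LorentzianMetric.mem_chronologicalFuture_trans hyF hmy⟩

end Ambient

/-! ### §4 The d.o.c., the horizon and the black-hole region of `M_ext` inside a sub-spacetime `U ⊇ M_ext ∪ ⟨⟨M_ext⟩⟩` -/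

variable {Mext : Set 𝓢.carrier}

/-- **`⟨⟨M_ext⟩⟩ ⊆ ⟨⟨M_ext⟩⟩_U`**: if `M_ext ∪ ⟨⟨M_ext⟩⟩ ⊆ U`, every point of the d.o.c. of `M_ext` in `𝓢` lies in the
d.o.c. of `M_ext` computed in the sub-spacetime `𝓢|_U` — the witnessing timelike curves run in
`M_ext ∪ ⟨⟨M_ext⟩⟩ ⊆ U` (§3) and are therefore curves of `𝓢|_U` (§2). Wald 1984, §12.1. [cite: Wald1984, §12.1] -/
theorem preimage_docOfEnd_subset_restrict (hMU : Mext ⊆ U) (hdoc : 𝓢.docOfEnd Mext ⊆ U) :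
    Subtype.val ⁻¹' 𝓢.docOfEnd Mext ⊆
      (𝓢.restrict PseudoRiemannianMetric.contMDiff_restrict_holds 𝓢.timeOrientation.contMDiff_restrict_holds
        U hU).docOfEnd (Subtype.val ⁻¹' Mext) := by
  intro x hx
  obtain ⟨hxF, hxP⟩ := hx
  constructor
  · -- `x ∈ I⁺_U(M_ext)`
    obtain ⟨p, hp, γ, a, b, hab, hγ, hpa, hxb⟩ := hxF
    have hmem : ∀ t ∈ Icc a b, γ t ∈ U := by
      intro t ht
      rcases ht.1.eq_or_lt with rfl | hat
      · rw [hpa]; exact hMU hp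
      · refine hdoc (mem_docOfEnd_of_curve_from hγ (hpa ▸ hp) ?_ ⟨hat, ht.2⟩)
        rw [hxb]; exact hxP
    obtain ⟨γ', hγ'eq, hγ'⟩ := exists_curve_codRestrict_restrict hU hab.le hγ hmem
    refine ⟨⟨p, hMU hp⟩, hp, γ', a, b, hab, hγ', ?_, ?_⟩
    · exact Subtype.ext ((hγ'eq a ⟨le_rfl, hab.le⟩).trans hpa)
    · exact Subtype.ext ((hγ'eq b ⟨hab.le, le_rfl⟩).trans hxb)
  · -- `x ∈ I⁻_U(M_ext)`: read the witnessing curve from `x` to `m ∈ M_ext`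
    obtain ⟨m, hm, hmx⟩ := mem_chronologicalPast_iff_exists_mem_chronologicalFuture.1 hxP
    obtain ⟨x', hx', γ, a, b, hab, hγ, hxa, hmb⟩ := hmx
    rw [mem_singleton_iff] at hx'
    subst hx'
    have hmem : ∀ t ∈ Icc a b, γ t ∈ U := by
      intro t ht
      rcases ht.2.eq_or_lt with rfl | htb
      · rw [hmb]; exact hMU hm
      · exact hdoc (mem_docOfEnd_of_curve_to hγ (hxa ▸ hxF) (hmb ▸ hm) ⟨ht.1, htb⟩)
    obtain ⟨γ', hγ'eq, hγ'⟩ := exists_curve_codRestrict_restrict hU hab.le hγ hmem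
    refine mem_chronologicalPast_iff_exists_mem_chronologicalFuture.2 ⟨⟨m, hMU hm⟩, hm, ?_⟩
    refine ⟨x, rfl, γ', a, b, hab, hγ', ?_, ?_⟩
    · exact Subtype.ext ((hγ'eq a ⟨le_rfl, hab.le⟩).trans hxa)
    · exact Subtype.ext ((hγ'eq b ⟨hab.le, le_rfl⟩).trans hmb)

/-- **`⟨⟨M_ext⟩⟩_U ⊆ ⟨⟨M_ext⟩⟩`**: the d.o.c. computed in any sub-spacetime `U ⊇ M_ext` lies in the d.o.c. of `𝓢`
(`I^±_U ⊆ I^±`). Wald 1984, §12.1. [cite: Wald1984, §12.1] -/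
theorem docOfEnd_restrict_subset_preimage :
    (𝓢.restrict PseudoRiemannianMetric.contMDiff_restrict_holds 𝓢.timeOrientation.contMDiff_restrict_holds
        U hU).docOfEnd (Subtype.val ⁻¹' Mext) ⊆ Subtype.val ⁻¹' 𝓢.docOfEnd Mext := by
  rintro x ⟨hxF, hxP⟩
  have himg : Subtype.val '' (Subtype.val ⁻¹' Mext : Set U) ⊆ Mext := image_preimage_subset _ _
  exact ⟨LorentzianMetric.chronologicalFuture_mono himg
      (chronologicalFuture_restrict_subset_preimage hU _ hxF),
    LorentzianMetric.chronologicalFuture_mono himg (chronologicalPast_restrict_subset_preimage hU _ hxP)⟩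

/-- **The d.o.c. is computed inside any sub-spacetime containing `M_ext ∪ ⟨⟨M_ext⟩⟩`**:
`⟨⟨M_ext⟩⟩_U = ι⁻¹ ⟨⟨M_ext⟩⟩` (registered sub-goal `docOfEnd_restrict_eq_preimage` of stmt-FinalStateConjecture-17430:
the `j '' E'.doc = E.doc` clause of stub D for the sub-spacetime witness). Wald 1984, §12.1; Chruściel–Costa 2008,
§2.2. [cite: Wald1984, §12.1] -/
theorem docOfEnd_restrict_eq_preimage : ∀ {𝓢 : Spacetime.{0} 4} {U : Opens 𝓢.carrier} (hU : IsConnected (U : Set 𝓢.carrier)) {Mext : Set 𝓢.carrier}, Mext ⊆ U → 𝓢.docOfEnd Mext ⊆ U → (𝓢.restrict PseudoRiemannianMetric.contMDiff_restrict_holds 𝓢.timeOrientation.contMDiff_restrict_holds U hU).docOfEnd (Subtype.val ⁻¹' Mext) = Subtype.val ⁻¹' 𝓢.docOfEnd Mext :=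
  fun hU _ hMU hdoc ↦
    Subset.antisymm (docOfEnd_restrict_subset_preimage hU) (preimage_docOfEnd_subset_restrict hU hMU hdoc)

/-- **Image form**: `ι '' ⟨⟨M_ext⟩⟩_U = ⟨⟨M_ext⟩⟩` for `M_ext ∪ ⟨⟨M_ext⟩⟩ ⊆ U`. Wald 1984, §12.1. [cite: Wald1984, §12.1] -/
theorem image_val_docOfEnd_restrict (hMU : Mext ⊆ U) (hdoc : 𝓢.docOfEnd Mext ⊆ U) :
    Subtype.val ''
        (𝓢.restrict PseudoRiemannianMetric.contMDiff_restrict_holds 𝓢.timeOrientation.contMDiff_restrict_holds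
          U hU).docOfEnd (Subtype.val ⁻¹' Mext) = 𝓢.docOfEnd Mext := by
  rw [docOfEnd_restrict_eq_preimage hU hMU hdoc, image_preimage_eq_inter_range, Subtype.range_coe]
  exact inter_eq_left.2 hdoc

/-- **The future event horizon is computed inside any sub-spacetime containing `M_ext ∪ ⟨⟨M_ext⟩⟩`**:
`𝓔⁺_U = ι⁻¹ 𝓔⁺`. `⊇`: a horizon point `h ∈ U` is reached from `M_ext` by a timelike curve running in
`⟨⟨M_ext⟩⟩ ⊆ U` (`mem_docOfEnd_of_curve_from_of_mem_closure`), is not in the open set `I⁻(M_ext) ⊇ I⁻_U(M_ext)`, and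
lies in the closure of `ι⁻¹ ⟨⟨M_ext⟩⟩ ⊆ I⁻_U(M_ext)` (`ι` is an open map). `⊆`: `I^±_U ⊆ I^±`, `ι⁻¹ ⟨⟨M_ext⟩⟩ ⊆ I⁻_U(M_ext)`
and openness of `I⁻_U(M_ext)`. Wald 1984, §12.1; Chruściel–Costa 2008, §2.2, (2.3)–(2.5).
[cite: Wald1984, §12.1] -/
theorem futureEventHorizonOfEnd_restrict_eq_preimage (hMU : Mext ⊆ U) (hdoc : 𝓢.docOfEnd Mext ⊆ U) :
    (𝓢.restrict PseudoRiemannianMetric.contMDiff_restrict_holds 𝓢.timeOrientation.contMDiff_restrict_holds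
        U hU).futureEventHorizonOfEnd (Subtype.val ⁻¹' Mext) =
      Subtype.val ⁻¹' 𝓢.futureEventHorizonOfEnd Mext := by
  set R := 𝓢.restrict PseudoRiemannianMetric.contMDiff_restrict_holds 𝓢.timeOrientation.contMDiff_restrict_holds
    U hU
  set P := 𝓢.metric.chronologicalPast 𝓢.timeOrientation Mext
  set F := 𝓢.metric.chronologicalFuture 𝓢.timeOrientation Mext
  set PR := R.metric.chronologicalPast R.timeOrientation (Subtype.val ⁻¹' Mext)
  set FR := R.metric.chronologicalFuture R.timeOrientation (Subtype.val ⁻¹' Mext)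
  have hPo : IsOpen P := LorentzianMetric.isOpen_chronologicalPast_of_boundaryless _ _ _
  have hFo : IsOpen F := LorentzianMetric.isOpen_chronologicalFuture_of_boundaryless _ _ _
  have hPRo : IsOpen PR := LorentzianMetric.isOpen_chronologicalPast_of_boundaryless _ _ _
  have himg : Subtype.val '' (Subtype.val ⁻¹' Mext : Set U) ⊆ Mext := image_preimage_subset _ _
  have hα : PR ⊆ Subtype.val ⁻¹' P := fun x hx ↦
    LorentzianMetric.chronologicalFuture_mono himg (chronologicalPast_restrict_subset_preimage hU _ hx)
  have hα' : FR ⊆ Subtype.val ⁻¹' F := fun x hx ↦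
    LorentzianMetric.chronologicalFuture_mono himg (chronologicalFuture_restrict_subset_preimage hU _ hx)
  have hβ : Subtype.val ⁻¹' 𝓢.docOfEnd Mext ⊆ PR ∩ FR := fun x hx ↦
    (preimage_docOfEnd_subset_restrict hU hMU hdoc hx).symm
  have hval : IsOpenMap (Subtype.val : U → 𝓢.carrier) := U.isOpen.isOpenMap_subtype_val
  have hcl := hval.preimage_closure_eq_closure_preimage continuous_subtype_val P
  ext h
  change h ∈ frontier PR ∩ FR ↔ h.1 ∈ frontier P ∩ F
  rw [hPRo.frontier_eq, hPo.frontier_eq]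
  constructor
  · rintro ⟨⟨hcl', hnP⟩, hFR'⟩
    refine ⟨⟨?_, fun hP' ↦ hnP (hβ ⟨hα' hFR', hP'⟩).1⟩, hα' hFR'⟩
    change h ∈ Subtype.val ⁻¹' closure P
    exact hcl ▸ closure_mono hα hcl'
  · rintro ⟨⟨hclP, hnP⟩, hF'⟩
    refine ⟨⟨?_, fun hPR' ↦ hnP (hα hPR')⟩, ?_⟩
    · -- `h ∈ closure (I⁻_U M_ext)`, through `ι⁻¹ ⟨⟨M_ext⟩⟩`
      have h1 : h.1 ∈ closure (𝓢.docOfEnd Mext) := hFo.inter_closure (t := P) ⟨hF', hclP⟩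
      have h2 : h ∈ closure (Subtype.val ⁻¹' 𝓢.docOfEnd Mext) := by
        rwa [← hval.preimage_closure_eq_closure_preimage continuous_subtype_val]
      exact closure_mono (fun x hx ↦ (hβ hx).1) h2
    · -- `h ∈ I⁺_U(M_ext)`: the curve from `M_ext` to `h` runs in `⟨⟨M_ext⟩⟩ ∪ M_ext ∪ {h} ⊆ U`
      obtain ⟨p, hp, γ, a, b, hab, hγ, hpa, hhb⟩ := hF'
      have hmem : ∀ t ∈ Icc a b, γ t ∈ U := by
        intro t ht
        rcases ht.1.eq_or_lt with rfl | hat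
        · rw [hpa]; exact hMU hp
        rcases ht.2.eq_or_lt with rfl | htb
        · rw [hhb]; exact h.2
        · exact hdoc (mem_docOfEnd_of_curve_from_of_mem_closure hγ (hpa ▸ hp) (hhb ▸ hclP) ⟨hat, htb⟩)
      obtain ⟨γ', hγ'eq, hγ'⟩ := exists_curve_codRestrict_restrict hU hab.le hγ hmem
      refine ⟨⟨p, hMU hp⟩, hp, γ', a, b, hab, hγ', ?_, ?_⟩
      · exact Subtype.ext ((hγ'eq a ⟨le_rfl, hab.le⟩).trans hpa)
      · exact Subtype.ext ((hγ'eq b ⟨hab.le, le_rfl⟩).trans hhb)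

/-- **The black-hole region only grows under restriction**: `ι⁻¹ B ⊆ B_U` (`I⁻_U(M_ext) ⊆ I⁻(M_ext)`).
Chruściel–Costa 2008, (2.3). [cite: ChruscielCosta2008, §2.2] -/
theorem preimage_blackHoleRegionOfEnd_subset_restrict :
    Subtype.val ⁻¹' 𝓢.blackHoleRegionOfEnd Mext ⊆
      (𝓢.restrict PseudoRiemannianMetric.contMDiff_restrict_holds 𝓢.timeOrientation.contMDiff_restrict_holds
        U hU).blackHoleRegionOfEnd (Subtype.val ⁻¹' Mext) := by
  intro x hx hxP
  have himg : Subtype.val '' (Subtype.val ⁻¹' Mext : Set U) ⊆ Mext := image_preimage_subset _ _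
  exact hx (LorentzianMetric.chronologicalFuture_mono himg (chronologicalPast_restrict_subset_preimage hU _ hxP))

/-- **A horizon point lies in the black-hole region** (`I⁻(M_ext)` is open, hence disjoint from its frontier).
Chruściel–Costa 2008, §2.2. [cite: ChruscielCosta2008, §2.2] -/
theorem futureEventHorizonOfEnd_subset_blackHoleRegionOfEnd :
    𝓢.futureEventHorizonOfEnd Mext ⊆ 𝓢.blackHoleRegionOfEnd Mext := fun h hh hhP ↦
  (Set.ext_iff.1 (LorentzianMetric.isOpen_chronologicalPast_of_boundaryless 𝓢.metric 𝓢.timeOrientation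
    Mext).inter_frontier_eq h).1 ⟨hhP, hh.1⟩

/-- **If `U` contains one point of the future event horizon of `M_ext`, the black-hole region of `M_ext` in `𝓢|_U`
is nonempty** (the `(blackHoleRegionOfEnd …).Nonempty` clause of the representative in stub D for the
sub-spacetime witness `U ⊇ ⟨⟨M_ext⟩⟩ ∪ M_ext ∪ {h}`). Chruściel–Costa 2008, §2.2. [cite: ChruscielCosta2008, §2.2] -/
theorem blackHoleRegionOfEnd_restrict_nonempty_of_mem_horizon {h : 𝓢.carrier}
    (hh : h ∈ 𝓢.futureEventHorizonOfEnd Mext) (hhU : h ∈ U) :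
    ((𝓢.restrict PseudoRiemannianMetric.contMDiff_restrict_holds 𝓢.timeOrientation.contMDiff_restrict_holds
        U hU).blackHoleRegionOfEnd (Subtype.val ⁻¹' Mext)).Nonempty :=
  ⟨⟨h, hhU⟩, preimage_blackHoleRegionOfEnd_subset_restrict hU
    (futureEventHorizonOfEnd_subset_blackHoleRegionOfEnd hh)⟩

end Summit.FinalStateConjecture.FinalStateConjecture.Theorems.TameLaSalle

end
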